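import Summits.QuantumFields.YangMills.Theorems.BalabanUVNodesN20OffLiveOneTermReading
import Summits.QuantumFields.YangMills.Theorems.BalabanUVNodesN20Stub2ShareK3AxV8

/-!
# BalabanUVNodes ∕ N20 — THE OFF-LIVE ONE-TERM READING, χ-GENERIC («Cmap») AND RE-CENTRED (`crOneTerm₁₃Cmap Χ K₀`, `crOneTerm₁₃Ax K₀`), ITS FOUR FACES AT THE K3ᴬ v8
# MIRROR, THE LIVE-PIN GLUE FOR A SPLIT READING, AND THE STUB-2 BILL ON THE SPLIT READING `crGap2₁₃VAx 0 … ∕ crOneTerm₁₃Ax 0` WITH NODE N20 PAID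

Cell `pub-ymgap` (HUMAN RULING D-0062, Track A), seat `pub-ymgap-dag-n20-d` (gen 46; R134 (a) N20 s3).  `--kind definition --supports stmt-QuantumFields-27247 --as helper` (one `def` +
one `abbrev`: a READING; count-neutral; proves NO registered stub; nothing registered).  The χ-generic ∕ re-centred twin of dag-n20-w1's `Thm/BalabanUVNodesN20OffLiveOneTermReading`
§3–§4 (`crOneTerm₁₃ K₀ : SpineReading₁₃CoPH N`, p598780 lineage) and of dag-n21-d's live-pin glue `Thm/BalabanUVNodesN21GappedRoadK3V6Knit` §1 (`keyed*_of_livePin`,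
`exists_reading_livePin`) AT THE K3ᴬ v8 MIRROR `Thm/BalabanUVNodesK3AxV8Defs` (dag-n16-e ✓p812015; registered kit `K3Skeleton13SepCoPHAxV8` b38fad1764a2d455 on stmt-QuantumFields-27247).
[LF-II] = [Balaban1989LargeFieldII].

WHY.  v8's stub 2 pins the spine reading `cr` to `crGap2₁₃VAx (jc …) ρ ρ′ n₁ n₂` ONLY ON THE LIVE-SELECTOR LINE (`PinnedAtLiveGap2`: `LiveSel F θ → cr … = …`) while its four face
conjuncts `KeyedRelWeight ∕ KeyedShellWeight ∕ KeyedExtractionV ∕ KeyedCoreEdgeHolderD4V` read `cr` at EVERY guarded admissible tuple; the N21 ∕ N27x faces of a gapped reading are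
theorems on the live line only (rows `hsel` + (H-ζ)).  The v7 closers' device (dag-n20-c ∕ dag-n20-w1 ∕ dag-n21-d) is the SPLIT READING: the gapped reading on the live line, the
ONE-TERM reading (one class per cutoff = the run's whole dressed partition function, no bad class, no shells) off it, where N20 ∕ N21 ∕ N27x hold OUTRIGHT and the N19′ core IS node
U5's TARGET at the datum.  Neither the one-term reading nor the glue existed at the re-centred χ-reading; this file supplies them, so that this lineage's N20 share (✓p812358
`keyedRelWeight_crGap2₁₃VAx_cutZero`) serves the PRACTICAL (split) closer shape too:
* §0 `schemeZ_pos_datumOfRecord₁₃CoPHChi` (the χ-datum's dressed partition functions are positive: n27-a's `schemeZ_scheme_pos` at `isPrintedAveraged_datumOfRecord₁₃CoPH_chi`);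
* §1 `crOneTerm₁₃Cmap Χ K₀ : SpineReading₁₃CoPHCmap N Χ` (dag-n20-w1's `oneTermCarriers 1 (F.side⁴) K₀ (schemeZ ((datumOfRecord₁₃CoPHChi … hP).scheme g₀) os)`), `rfl` unfolding, RECEIPT
  `crOneTerm₁₃Cmap_chiβ` at the record's own β-slot (`= crOneTerm₁₃ K₀` at the transported provisos, `rfl`);
* §2 its faces at EVERY χ-keyed tuple: `extraction_ ∕ relWeightBound_ ∕ shellWeightBound_ ∕ lt_one_crOneTerm₁₃Cmap` (outright) and ★ `core_crOneTerm₁₃Cmap_iff_target` (the N19′ core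
  ⟺ node U5's `NE7.Target (F.side⁴) 1 δ (K ↦ Z_{K₀+K})` at the χ-datum — NOT PRINTED for `d = 4`, displayed);
* §3 `crOneTerm₁₃Ax K₀ : SpineReading₁₃CoPHAx N` (re-centred);
* §4 AT THE MIRROR (`N = 2`): `keyedRelWeight_ ∕ keyedShellWeight_ ∕ keyedExtractionV_crOneTerm₁₃Ax` OUTRIGHT (every tuple) and `keyedCoreEdgeHolderD4V_crOneTerm₁₃Ax_of_target` (from node
  U5's target at the datum under the rates — HYPOTHESIS);
* §5 THE LIVE-PIN GLUE for a reading `cr` pinned to ANY live reading `crL` on the live line and to `crOneTerm₁₃Ax 0` off it: `keyedRelWeight_ ∕ keyedShellWeight_ ∕ keyedExtractionBFree_ ∕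
  keyedExtractionV_ ∕ keyedCoreEdgeHolderD4V_of_livePin` (the live-line content as HYPOTHESES, the off-line branch from §4) and `exists_reading_livePin` (the split reading, classical
  `if`);
* §6 ★★ NODE N20 ON THE GAP-PINNED SPLIT READING: `keyedRelWeight_of_liveGap2Pin_cutZero` — `PinnedAtLiveGap2 (fun _ _ _ _ _ ↦ fun _ ↦ 0) ρ ρ′ n₁ n₂ cr` + the off-live pin ⟹
  `KeyedRelWeight cr`, HYPOTHESIS-FREE beyond the two pins (✓p812358 on the line, §4 off it) · `keyedRelWeight_of_liveGap2Pin_of_witness` (any cut reading; N20's PRICED witness family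
  asked on the live line only);
* §7 ★★ THE SPLIT BILL `stub2Text_of_liveFaces_cutZero`: per `β` and guarded K4-faced reading, dials with `DialRows` + the N21 ∕ N27x ∕ N19′ faces at `crGap2₁₃VAx (fun _ ↦ 0) ρ ρ′ n₁ n₂`
  ON THE LIVE LINE ONLY + node U5's target at the datum OFF it ⟹ THE REGISTERED STUB-2 TEXT (byte for byte; the reading minted by `exists_reading_livePin`; N20 and the pin paid
  here).  After this file a v8 stub-2 closer at the zero cut owes exactly: the dial rows, `ShellWeightBound` ∕ extraction ∕ `NE7.Core` at the cut-zero doubly-gapped RE-CENTRED reading on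
  the live line, and node U5's target off it — the OTHER lanes' content, all HYPOTHESES here.
Cited BY NAME, not re-typed: dag-n20-w1 `…N20OffLiveOneTermReading` (`oneTermCarriers` + its generic faces), dag-n21-d `…N21GappedRoadK3V6Knit` (proof pattern of §5, re-keyed),
dag-n16-e `…K3AxV8Defs`, n27-a `schemeZ_scheme_pos`, this lineage ✓p811026 ∕ ✓p812358, `Node00.isPrintedAveraged_datumOfRecord₁₃CoPH_chi`.

HONEST FRAMING.  A DEFINITION of a reading + [folklore] singleton-sum ∕ case-split bookkeeping BY NAME; NO estimate.  The one-term reading books NO class decomposition: at it NE7 ∕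
NE7b ∕ NE7c collapse into node U5's TARGET at the datum (NOT PRINTED for `d = 4` — [LF-II] Thm 1 p.355 is ultraviolet stability, not matching of consecutive cutoffs — NOT proved;
every `…_of_target` statement takes it as a DISPLAYED hypothesis, inhabited for no family).  §5–§7's live-line faces are the OTHER lanes' content, HYPOTHESES asserted for no family;
NO stub of K3ᴬ v8 is closed or claimed (0∕2); no `Provisos₁₃CoPHChi ∕ …Ax` inhabitant claimed (K0ᴬ OPEN); N19 ∕ N20 ∕ N21 ∕ N27 NOT discharged; counts UNMOVED (typed 28∕28 ·
discharged 8∕27 · A 8∕28 · K 1∕4).  One finite `𝕋⁴_{L^K}` programme at fixed `ε = L^{−K}`, Bałaban AS PRINTED — NOT ℝ⁴, NOT infinite volume, NOT OS, NOT a mass gap; the YM mass gap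
(Clay) is NOT proved by any of this.  No `instance`, no `notation`, no `sorry`, standard axioms.
Sources (locators, bookkeeping only): [LF-II] Thm 1 + (0.1) pp.355–356, (1.80) p.384; [Balaban1989LargeFieldI] (0.2)–(0.4) p.176; [King1986] (3.10)–(3.11) p.656.
-/

set_option autoImplicit false

noncomputable section

open scoped BigOperators

namespace Summit.QuantumFields.YangMills.BalabanUVNodes.N20OffLiveOneTermReadingCmap

open Literature.MathematicalPhysics.QuantumFieldTheory.Balaban1983to89 Literature.MathematicalPhysics.QuantumFieldTheory.Balaban1983to89.Node00
open T4Continuum Summit.QuantumFields.BalabanUV.T4Continuum.Spine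
open T4WeightBudget (RelWeightBound)
open T4IndicatorShell (ShellWeightBound)
open Literature.MathematicalPhysics.QuantumFieldTheory.Balaban1983to89.T4ContinuumYM4Torus (ForSmallCouplings)
open NE7 (Target)
open YMDAG.UVSplit hiding SU
open Summit.QuantumFields.YangMills.BalabanUVNodes.N20OffLiveOneTermReading (oneTermCarriers oneTerm_E1 oneTerm_E2 relWeightBound_oneTermCarriers
  shellWeightBound_oneTermCarriers lt_one_oneTermCarriers core_oneTermCarriers_iff_target crOneTerm₁₃)
open Summit.QuantumFields.YangMills.Theorems.BalabanUVNodesN27SpineRecord (schemeZ_scheme_pos)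
open Summit.QuantumFields.YangMills.Theorems.N21ShellSplitOfRecord13CoPH (WidthLetter₁₃CoPHAx DepthLetter₁₃CoPHAx)
open Summit.QuantumFields.YangMills.Theorems.N21GappedTopPair13CoPH (gapWeight2A₁₃Chi gapWeight2B₁₃Chi crGap2₁₃VAx)
open Summit.QuantumFields.YangMills.Theorems.K3AxV8Defs
open Summit.QuantumFields.YangMills.BalabanUVNodes.N20KeyedRelWeightAtGap2ReadingCmap (relWeightBound_crGap2₁₃VAtCmap)
open Summit.QuantumFields.YangMills.BalabanUVNodes.N20Stub2ShareK3AxV8 (keyedRelWeight_crGap2₁₃VAx_cutZero)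

variable {F : T4Family} {N : ℕ} [NeZero N]

/-! ## §0  The χ-datum's dressed partition functions are positive -/

/-- **`0 < Z_K(t)` AT THE χ-GENERIC CoPH DATUM OF RECORD**, every `θ χ hP g₀ os K t` (n27-a's `schemeZ_scheme_pos`: ferromagnetic Wilson weight, `1`-bounded measurable observables;
measurability from `Node00.isPrintedAveraged_datumOfRecord₁₃CoPH_chi`).  The χ-twin of `N20AtRecord13.schemeZ_pos_datumOfRecord₁₃CoPH`. [bookkeeping] -/
theorem schemeZ_pos_datumOfRecord₁₃CoPHChi (θ : Stage13HParams F N) (χ : ChiSlot F N) (hP : θ.Provisos₁₃CoPHChi F N χ) (g₀ : ℕ → ℝ) (os : List (ULoop F)) (K : ℕ)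
    (t : ℝ) : 0 < T4GenFunBounds.schemeZ ((datumOfRecord₁₃CoPHChi F N θ χ hP).scheme g₀) os K t :=
  schemeZ_scheme_pos (datumOfRecord₁₃CoPHChi F N θ χ hP) (isPrintedAveraged_datumOfRecord₁₃CoPH_chi F N θ χ hP).avgMeasurable g₀ os K t

/-! ## §1  The one-term reading at the χ-keyed Stage-13 record -/

/-- ★ **THE ONE-TERM READING AT THE χ-GENERIC STAGE-13 RECORD** (offset `K₀`): at every χ-keyed tuple `(F, θ, hP, g₀, os)` dag-n20-w1's one-term bundle of the tuple's OWN dressed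
partition functions `schemeZ ((datumOfRecord₁₃CoPHChi F N θ (Χ F θ) hP).scheme g₀) os` at radius `1` and volume letter `F.side ^ 4`.  A legitimate value of v8's free spine reading
OFF the live-selector line. [cite: Balaban1989LargeFieldII, Thm 1 + (0.1) pp.355–356 (bookkeeping)] -/
def crOneTerm₁₃Cmap (Χ : (F : T4Family) → Stage13Params F N → ChiSlot F N) (K₀ : ℕ) : SpineReading₁₃CoPHCmap N Χ := fun F θ hP g₀ os =>
  oneTermCarriers 1 ((F.side : ℝ) ^ 4) K₀ (T4GenFunBounds.schemeZ ((datumOfRecord₁₃CoPHChi F N θ (Χ F θ.toStage13Params) hP).scheme g₀) os)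

section Reading

variable (Χ : (F : T4Family) → Stage13Params F N → ChiSlot F N) (K₀ : ℕ) (θ : Stage13HParams F N) (hP : θ.Provisos₁₃CoPHChi F N (Χ F θ.toStage13Params))
  (g₀ : ℕ → ℝ) (os : List (ULoop F))

/-- The reading IS the one-term bundle of the tuple's χ-datum partition functions (`rfl`). [bookkeeping] -/
theorem crOneTerm₁₃Cmap_eq : crOneTerm₁₃Cmap Χ K₀ F θ hP g₀ os =
    oneTermCarriers 1 ((F.side : ℝ) ^ 4) K₀ (T4GenFunBounds.schemeZ ((datumOfRecord₁₃CoPHChi F N θ (Χ F θ.toStage13Params) hP).scheme g₀) os) := rfl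

/-! ## §2  Its faces at every χ-keyed tuple -/

/-- **THE EXTRACTION FACE AT THE χ-ONE-TERM READING HOLDS AT EVERY TUPLE AND EVERY `g₀`** (`0 < l₀`, `0 < vol`, E1 ∕ E2 over the singleton class); NO selector pin, NO (H-U) ∕ (H-ζ)
law. [bookkeeping] -/
theorem extraction_crOneTerm₁₃Cmap :
    0 < (crOneTerm₁₃Cmap Χ K₀ F θ hP g₀ os).l₀ ∧ 0 < (crOneTerm₁₃Cmap Χ K₀ F θ hP g₀ os).vol ∧
      (∀ (K : ℕ) (t : ℝ), |t| ≤ (crOneTerm₁₃Cmap Χ K₀ F θ hP g₀ os).l₀ →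
        T4GenFunBounds.schemeZ ((datumOfRecord₁₃CoPHChi F N θ (Χ F θ.toStage13Params) hP).scheme g₀) os ((crOneTerm₁₃Cmap Χ K₀ F θ hP g₀ os).K₀ + K) t =
          ∑ τ ∈ (crOneTerm₁₃Cmap Χ K₀ F θ hP g₀ os).T K, (crOneTerm₁₃Cmap Χ K₀ F θ hP g₀ os).A K t τ) ∧
      (∀ (K : ℕ) (t : ℝ), |t| ≤ (crOneTerm₁₃Cmap Χ K₀ F θ hP g₀ os).l₀ →
        T4GenFunBounds.schemeZ ((datumOfRecord₁₃CoPHChi F N θ (Χ F θ.toStage13Params) hP).scheme g₀) os ((crOneTerm₁₃Cmap Χ K₀ F θ hP g₀ os).K₀ + K + 1) t =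
          ∑ τ ∈ (crOneTerm₁₃Cmap Χ K₀ F θ hP g₀ os).T K, (crOneTerm₁₃Cmap Χ K₀ F θ hP g₀ os).B K t τ) :=
  ⟨one_pos, pow_pos F.side_pos 4, fun K t _ => oneTerm_E1 K₀ _ K t, fun K t _ => oneTerm_E2 K₀ _ K t⟩

/-- **N20 AT THE χ-ONE-TERM READING: OUTRIGHT**, every tuple (no bad class, zero weight). [cite: King1986, (3.10) p.656 (bookkeeping)] -/
theorem relWeightBound_crOneTerm₁₃Cmap :
    RelWeightBound (crOneTerm₁₃Cmap Χ K₀ F θ hP g₀ os).l₀ (crOneTerm₁₃Cmap Χ K₀ F θ hP g₀ os).T (crOneTerm₁₃Cmap Χ K₀ F θ hP g₀ os).A (crOneTerm₁₃Cmap Χ K₀ F θ hP g₀ os).B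
      (crOneTerm₁₃Cmap Χ K₀ F θ hP g₀ os).Bad (crOneTerm₁₃Cmap Χ K₀ F θ hP g₀ os).W :=
  relWeightBound_oneTermCarriers 1 _ K₀ _

/-- **N21 AT THE χ-ONE-TERM READING: OUTRIGHT**, every tuple (zero shells; the χ-datum's partition functions are positive, §0). [cite: King1986, (3.10)–(3.11) p.656 (bookkeeping)] -/
theorem shellWeightBound_crOneTerm₁₃Cmap :
    ShellWeightBound (crOneTerm₁₃Cmap Χ K₀ F θ hP g₀ os).l₀ (crOneTerm₁₃Cmap Χ K₀ F θ hP g₀ os).T (crOneTerm₁₃Cmap Χ K₀ F θ hP g₀ os).A (crOneTerm₁₃Cmap Χ K₀ F θ hP g₀ os).B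
      (crOneTerm₁₃Cmap Χ K₀ F θ hP g₀ os).shA (crOneTerm₁₃Cmap Χ K₀ F θ hP g₀ os).shB (crOneTerm₁₃Cmap Χ K₀ F θ hP g₀ os).Wsh :=
  shellWeightBound_oneTermCarriers 1 _ K₀ _ fun K t _ => (schemeZ_pos_datumOfRecord₁₃CoPHChi θ _ hP g₀ os K t).le

/-- U4′'s `W + Wsh < 1` at the χ-one-term reading (`0 + 0 < 1`). [bookkeeping] -/
theorem lt_one_crOneTerm₁₃Cmap (K : ℕ) : (crOneTerm₁₃Cmap Χ K₀ F θ hP g₀ os).W K + (crOneTerm₁₃Cmap Χ K₀ F θ hP g₀ os).Wsh K < 1 :=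
  lt_one_oneTermCarriers 1 _ K₀ _ K

/-- ★ **THE N19′ FACE AT THE χ-ONE-TERM READING IS NODE U5's TARGET AT THE χ-DATUM**: `∃ δ, NE7.Core … δ ∧ Summable δ` at the reading's carriers ⟺ `∃ δ, Target (F.side ^ 4) 1 δ
(fun K ↦ schemeZ ((datumOfRecord₁₃CoPHChi … hP).scheme g₀) os (K₀ + K))` — matching of consecutive dressed partition functions modulo `t`-independent constants on `|t| ≤ 1`,
summable remainder.  NOT PRINTED for `d = 4`, NOT proved; displayed. [cite: Balaban1989LargeFieldII, Thm 1 + (0.1) pp.355–356 (bookkeeping)] -/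
theorem core_crOneTerm₁₃Cmap_iff_target :
    (letI := (crOneTerm₁₃Cmap Χ K₀ F θ hP g₀ os).dec
     ∃ δ : ℕ → ℝ, NE7.Core (crOneTerm₁₃Cmap Χ K₀ F θ hP g₀ os).l₀ (crOneTerm₁₃Cmap Χ K₀ F θ hP g₀ os).vol (crOneTerm₁₃Cmap Χ K₀ F θ hP g₀ os).T
        (crOneTerm₁₃Cmap Χ K₀ F θ hP g₀ os).Bad
        (fun K t τ => (crOneTerm₁₃Cmap Χ K₀ F θ hP g₀ os).A K t τ - (crOneTerm₁₃Cmap Χ K₀ F θ hP g₀ os).shA K t τ)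
        (fun K t τ => (crOneTerm₁₃Cmap Χ K₀ F θ hP g₀ os).B K t τ - (crOneTerm₁₃Cmap Χ K₀ F θ hP g₀ os).shB K t τ) δ ∧ Summable δ) ↔
      ∃ δ : ℕ → ℝ, Target ((F.side : ℝ) ^ 4) 1 δ
        (fun K => T4GenFunBounds.schemeZ ((datumOfRecord₁₃CoPHChi F N θ (Χ F θ.toStage13Params) hP).scheme g₀) os (K₀ + K)) :=
  core_oneTermCarriers_iff_target 1 _ K₀ _ fun K t _ => schemeZ_pos_datumOfRecord₁₃CoPHChi θ _ hP g₀ os K t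

end Reading

/-- **RECEIPT** at the record's own β-slot `Χ := chiβOfRecord₁₃`: the χ-one-term reading IS dag-n20-w1's `crOneTerm₁₃ K₀` at the transported provisos (`rfl`: the χ-datum at
`chiβOfRecord₁₃ θ` is the CoPH datum). [bookkeeping] -/
theorem crOneTerm₁₃Cmap_chiβ (K₀ : ℕ) (θ : Stage13HParams F N) (hP : θ.Provisos₁₃CoPHChi F N (chiβOfRecord₁₃ F N θ.toStage13Params)) (g₀ : ℕ → ℝ)
    (os : List (ULoop F)) :
    crOneTerm₁₃Cmap (fun F => chiβOfRecord₁₃ F N) K₀ F θ hP g₀ os = crOneTerm₁₃ K₀ F θ ((provisos₁₃CoPHChi_chiβ_iff θ).1 hP) g₀ os := rfl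

/-! ## §3  The RE-CENTRED instance (`Χ := chiβOfRecord₁₃Ax`) -/

/-- ★ **THE ONE-TERM READING, RE-CENTRED** — a value of the K3ᴬ v8 mirror's `SpineReading` (`= SpineReading₁₃CoPHAx 2` at `N = 2`). [bookkeeping] -/
abbrev crOneTerm₁₃Ax (K₀ : ℕ) : SpineReading₁₃CoPHAx N := crOneTerm₁₃Cmap (fun F => chiβOfRecord₁₃Ax F N) K₀

/-! ## §4  At the K3ᴬ v8 mirror (`N = 2`): the four face conjuncts at `crOneTerm₁₃Ax K₀` -/

section Mirror

variable (K₀ : ℕ)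

/-- **v8's N20 CONJUNCT AT THE RE-CENTRED ONE-TERM READING — OUTRIGHT** (every tuple; the guards unread). [cite: King1986, (3.10) p.656 (bookkeeping)] -/
theorem keyedRelWeight_crOneTerm₁₃Ax : KeyedRelWeight (crOneTerm₁₃Ax K₀) :=
  fun _ θ hP _ _ g₀ os => relWeightBound_crOneTerm₁₃Cmap _ K₀ θ hP g₀ os

/-- **v8's N21 CONJUNCT AT THE RE-CENTRED ONE-TERM READING — OUTRIGHT** (every tuple). [cite: King1986, (3.10)–(3.11) p.656 (bookkeeping)] -/
theorem keyedShellWeight_crOneTerm₁₃Ax : KeyedShellWeight (crOneTerm₁₃Ax K₀) :=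
  fun _ θ hP _ _ g₀ os => shellWeightBound_crOneTerm₁₃Cmap _ K₀ θ hP g₀ os

/-- **v8's (B)-FREE N27x FACE AT THE RE-CENTRED ONE-TERM READING — OUTRIGHT** (every tuple, every `g₀`: `ForSmallCouplings.of_forall`). [bookkeeping] -/
theorem keyedExtractionBFree_crOneTerm₁₃Ax : KeyedExtractionBFree (crOneTerm₁₃Ax K₀) :=
  fun _ θ hP _ _ => ForSmallCouplings.of_forall fun g₀ os => extraction_crOneTerm₁₃Cmap _ K₀ θ hP g₀ os

/-- **v8's slot-keyed N27x CONJUNCT AT THE RE-CENTRED ONE-TERM READING — OUTRIGHT** (the mirror's `keyedExtractionV_of_bFree`: the slot datum's partition functions are the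
record's). [bookkeeping] -/
theorem keyedExtractionV_crOneTerm₁₃Ax : KeyedExtractionV (crOneTerm₁₃Ax K₀) :=
  keyedExtractionV_of_bFree (keyedExtractionBFree_crOneTerm₁₃Ax K₀)

/-- ★ **v8's N19′ CONJUNCT AT THE RE-CENTRED ONE-TERM READING FROM NODE U5's TARGET AT THE DATUM**: IF at every guarded admissible tuple the rates `PHolderD4 β` at the reading `rr`
imply `∃ δ, Target (F.side^4) 1 δ (K ↦ schemeZ ((datumOfRecord₁₃CoPHAx F 2 θ hP).scheme g₀) os (K₀ + K))` — DISPLAYED, NOT PRINTED for `d = 4`, NOT proved — then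
`KeyedCoreEdgeHolderD4V β (crOneTerm₁₃Ax K₀) rr` (via the (B)-free shape and the mirror's `keyedCoreEdgeHolderD4V_of_bFree`). [cite: Balaban1989LargeFieldII, Thm 1 + (0.1) pp.355–356 (bookkeeping)] -/
theorem keyedCoreEdgeHolderD4V_crOneTerm₁₃Ax_of_target (β : ℝ) (rr : RateReadingFn)
    (htarget : ∀ (F : T4Family) (θ : Stage13HParams F 2) (hP : θ.Provisos₁₃CoPHAx F 2), (θ.ZhUnity F 2 ∧ θ.SlotsNondegenerate₁₃Ax F 2) → θ.Admissible F 2 →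
      ∀ (g₀ : ℕ → ℝ) (os : List (ULoop F)), PHolderD4 β (datumOfRecord₁₃CoPHAx F 2 θ hP) (rr F θ hP g₀ os) →
        ∃ δ : ℕ → ℝ, Target ((F.side : ℝ) ^ 4) 1 δ (fun K => T4GenFunBounds.schemeZ ((datumOfRecord₁₃CoPHAx F 2 θ hP).scheme g₀) os (K₀ + K))) :
    KeyedCoreEdgeHolderD4V β (crOneTerm₁₃Ax K₀) rr :=
  keyedCoreEdgeHolderD4V_of_bFree fun F θ hP hG hθ => ForSmallCouplings.of_forall fun g₀ os hPr =>
    (core_crOneTerm₁₃Cmap_iff_target _ K₀ θ hP g₀ os).2 (htarget F θ hP hG hθ g₀ os hPr)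

end Mirror

/-! ## §5  The live-pin glue at the mirror: a reading pinned to a live reading `crL` on the live-selector line and to `crOneTerm₁₃Ax 0` off it -/

section LivePin

variable {crL cr : SpineReading}
  (hon : ∀ (F : T4Family) (θ : Stage13HParams F 2) (hP : θ.Provisos₁₃CoPHAx F 2) (g₀ : ℕ → ℝ) (os : List (ULoop F)), LiveSel F θ → cr F θ hP g₀ os = crL F θ hP g₀ os)
  (hoff : ∀ (F : T4Family) (θ : Stage13HParams F 2) (hP : θ.Provisos₁₃CoPHAx F 2) (g₀ : ℕ → ℝ) (os : List (ULoop F)),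
    ¬ LiveSel F θ → cr F θ hP g₀ os = crOneTerm₁₃Ax 0 F θ hP g₀ os)
include hon hoff

/-- **N20's v8 conjunct on a live-pinned reading**: `RelWeightBound` at the live reading `crL` on the guarded admissible tuples OF THE LIVE LINE gives `KeyedRelWeight cr` — off the
line the one-term reading's weight is `0` (§4, outright). [cite: King1986, (3.10) p.656 (bookkeeping)] -/
theorem keyedRelWeight_of_livePin
    (hrel : ∀ (F : T4Family) (θ : Stage13HParams F 2) (hP : θ.Provisos₁₃CoPHAx F 2), ((θ.ZhUnity F 2 ∧ θ.SlotsNondegenerate₁₃Ax F 2) ∧ LiveSel F θ) → θ.Admissible F 2 →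
      ∀ (g₀ : ℕ → ℝ) (os : List (ULoop F)),
        RelWeightBound (crL F θ hP g₀ os).l₀ (crL F θ hP g₀ os).T (crL F θ hP g₀ os).A (crL F θ hP g₀ os).B (crL F θ hP g₀ os).Bad (crL F θ hP g₀ os).W) :
    KeyedRelWeight cr := by
  intro F θ hP hG hθ g₀ os
  by_cases hs : LiveSel F θ
  · rw [hon F θ hP g₀ os hs]
    exact hrel F θ hP ⟨hG, hs⟩ hθ g₀ os
  · rw [hoff F θ hP g₀ os hs]
    exact relWeightBound_crOneTerm₁₃Cmap _ 0 θ hP g₀ os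

/-- **N21's v8 conjunct on a live-pinned reading**: `ShellWeightBound` at `crL` on the guarded admissible tuples of the live line gives `KeyedShellWeight cr` (off the line the
one-term reading's shells are `0`, §4). [cite: King1986, (3.10)–(3.11) p.656 (bookkeeping)] -/
theorem keyedShellWeight_of_livePin
    (hshell : ∀ (F : T4Family) (θ : Stage13HParams F 2) (hP : θ.Provisos₁₃CoPHAx F 2), ((θ.ZhUnity F 2 ∧ θ.SlotsNondegenerate₁₃Ax F 2) ∧ LiveSel F θ) → θ.Admissible F 2 →
      ∀ (g₀ : ℕ → ℝ) (os : List (ULoop F)),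
        ShellWeightBound (crL F θ hP g₀ os).l₀ (crL F θ hP g₀ os).T (crL F θ hP g₀ os).A (crL F θ hP g₀ os).B (crL F θ hP g₀ os).shA (crL F θ hP g₀ os).shB
          (crL F θ hP g₀ os).Wsh) :
    KeyedShellWeight cr := by
  intro F θ hP hG hθ g₀ os
  by_cases hs : LiveSel F θ
  · rw [hon F θ hP g₀ os hs]
    exact hshell F θ hP ⟨hG, hs⟩ hθ g₀ os
  · rw [hoff F θ hP g₀ os hs]
    exact shellWeightBound_crOneTerm₁₃Cmap _ 0 θ hP g₀ os

/-- **N27x's (B)-free v8 face on a live-pinned reading**: the extraction identities at `crL` on the live line (under `ForSmallCouplings`, (B) ∕ END unread) give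
`KeyedExtractionBFree cr` (off the line E1 ∕ E2 at the one-term reading hold at every tuple and every `g₀`, §4). [bookkeeping] -/
theorem keyedExtractionBFree_of_livePin
    (hext : ∀ (F : T4Family) (θ : Stage13HParams F 2) (hP : θ.Provisos₁₃CoPHAx F 2), ((θ.ZhUnity F 2 ∧ θ.SlotsNondegenerate₁₃Ax F 2) ∧ LiveSel F θ) → θ.Admissible F 2 →
      ForSmallCouplings (datumOfRecord₁₃CoPHAx F 2 θ hP) fun g₀ => ∀ os : List (ULoop F),
        0 < (crL F θ hP g₀ os).l₀ ∧ 0 < (crL F θ hP g₀ os).vol ∧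
        (∀ (K : ℕ) (t : ℝ), |t| ≤ (crL F θ hP g₀ os).l₀ →
          T4GenFunBounds.schemeZ ((datumOfRecord₁₃CoPHAx F 2 θ hP).scheme g₀) os ((crL F θ hP g₀ os).K₀ + K) t =
            ∑ τ ∈ (crL F θ hP g₀ os).T K, (crL F θ hP g₀ os).A K t τ) ∧
        (∀ (K : ℕ) (t : ℝ), |t| ≤ (crL F θ hP g₀ os).l₀ →
          T4GenFunBounds.schemeZ ((datumOfRecord₁₃CoPHAx F 2 θ hP).scheme g₀) os ((crL F θ hP g₀ os).K₀ + K + 1) t =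
            ∑ τ ∈ (crL F θ hP g₀ os).T K, (crL F θ hP g₀ os).B K t τ)) :
    KeyedExtractionBFree cr := by
  intro F θ hP hG hθ
  by_cases hs : LiveSel F θ
  · refine ForSmallCouplings.mono (fun g₀ h os => ?_) (hext F θ hP ⟨hG, hs⟩ hθ)
    rw [hon F θ hP g₀ os hs]
    exact h os
  · exact ForSmallCouplings.of_forall fun g₀ os => by
      rw [hoff F θ hP g₀ os hs]
      exact extraction_crOneTerm₁₃Cmap _ 0 θ hP g₀ os

/-- … hence the slot-keyed v8 conjunct `KeyedExtractionV cr` (the mirror's `keyedExtractionV_of_bFree`). [bookkeeping] -/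
theorem keyedExtractionV_of_livePin
    (hext : ∀ (F : T4Family) (θ : Stage13HParams F 2) (hP : θ.Provisos₁₃CoPHAx F 2), ((θ.ZhUnity F 2 ∧ θ.SlotsNondegenerate₁₃Ax F 2) ∧ LiveSel F θ) → θ.Admissible F 2 →
      ForSmallCouplings (datumOfRecord₁₃CoPHAx F 2 θ hP) fun g₀ => ∀ os : List (ULoop F),
        0 < (crL F θ hP g₀ os).l₀ ∧ 0 < (crL F θ hP g₀ os).vol ∧
        (∀ (K : ℕ) (t : ℝ), |t| ≤ (crL F θ hP g₀ os).l₀ →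
          T4GenFunBounds.schemeZ ((datumOfRecord₁₃CoPHAx F 2 θ hP).scheme g₀) os ((crL F θ hP g₀ os).K₀ + K) t =
            ∑ τ ∈ (crL F θ hP g₀ os).T K, (crL F θ hP g₀ os).A K t τ) ∧
        (∀ (K : ℕ) (t : ℝ), |t| ≤ (crL F θ hP g₀ os).l₀ →
          T4GenFunBounds.schemeZ ((datumOfRecord₁₃CoPHAx F 2 θ hP).scheme g₀) os ((crL F θ hP g₀ os).K₀ + K + 1) t =
            ∑ τ ∈ (crL F θ hP g₀ os).T K, (crL F θ hP g₀ os).B K t τ)) :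
    KeyedExtractionV cr :=
  keyedExtractionV_of_bFree (keyedExtractionBFree_of_livePin hon hoff hext)

/-- **N19′'s slot-keyed v8 conjunct on a live-pinned reading**: the core at `crL` on the live line (slot-keyed, under (B) → END → `ForSmallCouplings` at the slot datum and
`PHolderD4 β`) AND node U5's Target at the datum off it (both HYPOTHESES; NE7 NOT PRINTED for `d = 4`) give `KeyedCoreEdgeHolderD4V β cr rr`.
[cite: Balaban1989LargeFieldII, Thm 1 + (0.1) pp.355–356 (bookkeeping)] -/
theorem keyedCoreEdgeHolderD4V_of_livePin (β : ℝ) (rr : RateReadingFn)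
    (h19on : ∀ (F : T4Family) (θ : Stage13HParams F 2) (h : θ.Provisos₁₃SepCoPHAx F 2) (v : Revision₁₃Ax F 2 θ h),
      ((θ.ZhUnity F 2 ∧ θ.SlotsNondegenerate₁₃Ax F 2) ∧ LiveSel F θ) → θ.Admissible F 2 →
      B16.EndStatementBPrinted (datumOfRecord₁₃SepCoPHVAx F 2 θ h v).C → DagBinding.EndpointExistence (datumOfRecord₁₃SepCoPHVAx F 2 θ h v).C.toB12 →
        ForSmallCouplings (datumOfRecord₁₃SepCoPHVAx F 2 θ h v) fun g₀ => ∀ os : List (ULoop F),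
          PHolderD4 β (datumOfRecord₁₃SepCoPHVAx F 2 θ h v) (rr F θ h.toCore g₀ os) → letI := (crL F θ h.toCore g₀ os).dec
            ∃ δ : ℕ → ℝ, NE7.Core (crL F θ h.toCore g₀ os).l₀ (crL F θ h.toCore g₀ os).vol (crL F θ h.toCore g₀ os).T (crL F θ h.toCore g₀ os).Bad
              (fun K t τ => (crL F θ h.toCore g₀ os).A K t τ - (crL F θ h.toCore g₀ os).shA K t τ)
              (fun K t τ => (crL F θ h.toCore g₀ os).B K t τ - (crL F θ h.toCore g₀ os).shB K t τ) δ ∧ Summable δ)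
    (h19off : ∀ (F : T4Family) (θ : Stage13HParams F 2) (hP : θ.Provisos₁₃CoPHAx F 2), ((θ.ZhUnity F 2 ∧ θ.SlotsNondegenerate₁₃Ax F 2) ∧ ¬ LiveSel F θ) →
      θ.Admissible F 2 → ∀ (g₀ : ℕ → ℝ) (os : List (ULoop F)), PHolderD4 β (datumOfRecord₁₃CoPHAx F 2 θ hP) (rr F θ hP g₀ os) →
        ∃ δ : ℕ → ℝ, Target ((F.side : ℝ) ^ 4) 1 δ (fun K => T4GenFunBounds.schemeZ ((datumOfRecord₁₃CoPHAx F 2 θ hP).scheme g₀) os (0 + K))) :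
    KeyedCoreEdgeHolderD4V β cr rr := by
  intro F θ h v hG hθ hB hE
  by_cases hs : LiveSel F θ
  · refine ForSmallCouplings.mono (fun g₀ h' os hPr => ?_) (h19on F θ h v ⟨hG, hs⟩ hθ hB hE)
    rw [hon F θ h.toCore g₀ os hs]
    exact h' os hPr
  · exact ForSmallCouplings.of_forall fun g₀ os hPr => by
      rw [hoff F θ h.toCore g₀ os hs]
      exact (core_crOneTerm₁₃Cmap_iff_target _ 0 θ h.toCore g₀ os).2 (h19off F θ h.toCore ⟨hG, hs⟩ hθ g₀ os hPr)

omit hon hoff in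
/-- **THE PIN PAIR IS INHABITED**: the split reading `if LiveSel F θ then crL … else crOneTerm₁₃Ax 0 …` (classical case split on the selector line). [bookkeeping] -/
theorem exists_reading_livePin (crL : SpineReading) :
    ∃ cr : SpineReading,
      (∀ (F : T4Family) (θ : Stage13HParams F 2) (hP : θ.Provisos₁₃CoPHAx F 2) (g₀ : ℕ → ℝ) (os : List (ULoop F)), LiveSel F θ → cr F θ hP g₀ os = crL F θ hP g₀ os) ∧
      (∀ (F : T4Family) (θ : Stage13HParams F 2) (hP : θ.Provisos₁₃CoPHAx F 2) (g₀ : ℕ → ℝ) (os : List (ULoop F)),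
        ¬ LiveSel F θ → cr F θ hP g₀ os = crOneTerm₁₃Ax 0 F θ hP g₀ os) := by
  classical
  exact ⟨fun F θ hP g₀ os => if LiveSel F θ then crL F θ hP g₀ os else crOneTerm₁₃Ax 0 F θ hP g₀ os,
    fun F θ hP g₀ os hs => if_pos hs, fun F θ hP g₀ os hs => if_neg hs⟩

end LivePin

/-! ## §6  Node N20 on the gap-pinned split reading -/

section GapPin

variable (ρ ρ' : WidthLetter₁₃CoPHAx 2) (n₁ n₂ : DepthLetter₁₃CoPHAx 2) {cr : SpineReading}
  (hoff : ∀ (F : T4Family) (θ : Stage13HParams F 2) (hP : θ.Provisos₁₃CoPHAx F 2) (g₀ : ℕ → ℝ) (os : List (ULoop F)),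
    ¬ LiveSel F θ → cr F θ hP g₀ os = crOneTerm₁₃Ax 0 F θ hP g₀ os)
include hoff

/-- **★★ NODE N20's v8 CONJUNCT ON THE GAP-PINNED SPLIT READING AT THE ZERO CUT READING — HYPOTHESIS-FREE BEYOND THE TWO PINS**: `PinnedAtLiveGap2 (fun _ _ _ _ _ ↦ fun _ ↦ 0) ρ ρ′ n₁ n₂ cr`
(v8's own pin) and the off-live pin to `crOneTerm₁₃Ax 0` give `KeyedRelWeight cr` — on the line ✓p812358 `keyedRelWeight_crGap2₁₃VAx_cutZero` (empty bad class), off it §4 (no bad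
class).  NO estimate; the conjunct books nothing at `jc ≡ 0`. [cite: King1986, (3.10) p.656; Balaban1989LargeFieldII, Thm 1 + (0.1) pp.355–356, (1.80) p.384 (bookkeeping)] -/
theorem keyedRelWeight_of_liveGap2Pin_cutZero (hon : PinnedAtLiveGap2 (fun _ _ _ _ _ => fun _ => 0) ρ ρ' n₁ n₂ cr) : KeyedRelWeight cr :=
  keyedRelWeight_of_livePin (crL := crGap2₁₃VAx (fun _ => 0) ρ ρ' n₁ n₂) hon hoff fun F θ hP hG hθ g₀ os =>
    keyedRelWeight_crGap2₁₃VAx_cutZero ρ ρ' n₁ n₂ F θ hP hG.1 hθ g₀ os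

/-- **★ NODE N20's v8 CONJUNCT ON THE GAP-PINNED SPLIT READING AT ANY CUT READING FROM A WITNESS FAMILY ASKED ON THE LIVE LINE ONLY** (`hW`: `RelWeightBound` witnesses at the
doubly-gapped re-centred carriers of `jc` on the guarded admissible tuples of the live line — node N20's PRICED face, a HYPOTHESIS; NE7b NOT PRINTED for `d = 4`).
[cite: Balaban1989LargeFieldII, Thm 1 + (0.1) pp.355–356, (1.79) p.383, (1.80) p.384, (1.89) p.387 (bookkeeping)] -/
theorem keyedRelWeight_of_liveGap2Pin_of_witness (jc : CutReading) (hon : PinnedAtLiveGap2 jc ρ ρ' n₁ n₂ cr)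
    (W : (F : T4Family) → (θ : Stage13HParams F 2) → θ.Provisos₁₃CoPHAx F 2 → (ℕ → ℝ) → List (ULoop F) → ℕ → ℝ)
    (hW : ∀ (F : T4Family) (θ : Stage13HParams F 2) (hP : θ.Provisos₁₃CoPHAx F 2), ((θ.ZhUnity F 2 ∧ θ.SlotsNondegenerate₁₃Ax F 2) ∧ LiveSel F θ) → θ.Admissible F 2 →
      ∀ (g₀ : ℕ → ℝ) (os : List (ULoop F)),
        RelWeightBound 1 (classSet₁₃Ax θ 0 g₀)
          (gapWeight2A₁₃Chi θ (chiβOfRecord₁₃Ax F 2 θ.toStage13Params) hP 0 g₀ os (ρ F θ hP g₀ os) (ρ' F θ hP g₀ os) (n₁ F θ hP g₀ os) (n₂ F θ hP g₀ os))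
          (gapWeight2B₁₃Chi θ (chiβOfRecord₁₃Ax F 2 θ.toStage13Params) hP 0 g₀ os (ρ F θ hP g₀ os) (ρ' F θ hP g₀ os) (n₁ F θ hP g₀ os) (n₂ F θ hP g₀ os))
          (badClass₁₃Ax θ 0 g₀ (jc F θ hP g₀ os)) (W F θ hP g₀ os)) :
    KeyedRelWeight cr :=
  keyedRelWeight_of_livePin (crL := fun F θ hP g₀ os => crGap2₁₃VAx (jc F θ hP g₀ os) ρ ρ' n₁ n₂ F θ hP g₀ os) hon hoff fun F θ hP hG hθ g₀ os =>
    relWeightBound_crGap2₁₃VAtCmap (fun F => chiβOfRecord₁₃Ax F 2) 0 _ ρ ρ' n₁ n₂ θ hP g₀ os (hW F θ hP hG hθ g₀ os)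

end GapPin

/-! ## §7  The stub-2 bill on the split reading at the zero cut reading, node N20 paid -/

/-- **★★ THE REGISTERED STUB-2 TEXT FROM THE OTHER LANES' FACES ON THE LIVE LINE ONLY + NODE U5's TARGET OFF IT, NODE N20 AND THE PIN PAID**: if for every `β` in print's window
and every guarded, K4-faced reading some dials `ρ ρ′ n₁ n₂` carry the dial rows and, ON THE GUARDED ADMISSIBLE TUPLES OF THE LIVE LINE, N21's `ShellWeightBound`, N27x's extraction
identities (under `ForSmallCouplings`) and N19′'s core (slot-keyed, under (B) → END → `ForSmallCouplings`, `PHolderD4 β`) at the cut-zero doubly-gapped re-centred reading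
`crGap2₁₃VAx (fun _ ↦ 0) ρ ρ′ n₁ n₂`, and OFF THE LIVE LINE node U5's target at the datum under the rates — ALL HYPOTHESES, the other lanes' content, NE7 ∕ NE7c NOT PRINTED for
`d = 4` — then the stub-2 TEXT (`K3Skeleton13SepCoPHAxV8.stub_expansion13HV`'s type ∕ `K3AxV8StubTexts.Stub2TextV8`, byte for byte) holds, the reading minted as the split reading
(`exists_reading_livePin`), `jc := fun _ _ _ _ _ ↦ fun _ ↦ 0`; node N20's conjunct by §6.  NO stub is proved here.
[cite: Balaban1989LargeFieldII, Thm 1 + (0.1) pp.355–356, (1.80) p.384; King1986, (3.10)–(3.11) p.656 (bookkeeping)] -/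
theorem stub2Text_of_liveFaces_cutZero
    (h : ∀ β : ℝ, 2 / 3 < β → β < 1 →
      ∀ (𝔯 : RateReading13AxP) (ksel : RunSel) (ℓ : LetterReading) (ℓ₃ : T4Family → Node00.NE3Letters₁₁) (g B : T4Family → ℝ),
        GuardedReadingN16 𝔯 ksel ℓ ℓ₃ g B → KeyedRatesHolderD4V β (rrOfRecord 𝔯 ksel) →
        ∃ (ρ ρ' : WidthLetter₁₃CoPHAx 2) (n₁ n₂ : DepthLetter₁₃CoPHAx 2), DialRows ρ ρ' n₁ n₂ ∧
          (∀ (F : T4Family) (θ : Stage13HParams F 2) (hP : θ.Provisos₁₃CoPHAx F 2), ((θ.ZhUnity F 2 ∧ θ.SlotsNondegenerate₁₃Ax F 2) ∧ LiveSel F θ) → θ.Admissible F 2 →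
            ∀ (g₀ : ℕ → ℝ) (os : List (ULoop F)),
              ShellWeightBound (crGap2₁₃VAx (fun _ => 0) ρ ρ' n₁ n₂ F θ hP g₀ os).l₀ (crGap2₁₃VAx (fun _ => 0) ρ ρ' n₁ n₂ F θ hP g₀ os).T
                (crGap2₁₃VAx (fun _ => 0) ρ ρ' n₁ n₂ F θ hP g₀ os).A (crGap2₁₃VAx (fun _ => 0) ρ ρ' n₁ n₂ F θ hP g₀ os).B
                (crGap2₁₃VAx (fun _ => 0) ρ ρ' n₁ n₂ F θ hP g₀ os).shA (crGap2₁₃VAx (fun _ => 0) ρ ρ' n₁ n₂ F θ hP g₀ os).shB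
                (crGap2₁₃VAx (fun _ => 0) ρ ρ' n₁ n₂ F θ hP g₀ os).Wsh) ∧
          (∀ (F : T4Family) (θ : Stage13HParams F 2) (hP : θ.Provisos₁₃CoPHAx F 2), ((θ.ZhUnity F 2 ∧ θ.SlotsNondegenerate₁₃Ax F 2) ∧ LiveSel F θ) → θ.Admissible F 2 →
            ForSmallCouplings (datumOfRecord₁₃CoPHAx F 2 θ hP) fun g₀ => ∀ os : List (ULoop F),
              0 < (crGap2₁₃VAx (fun _ => 0) ρ ρ' n₁ n₂ F θ hP g₀ os).l₀ ∧ 0 < (crGap2₁₃VAx (fun _ => 0) ρ ρ' n₁ n₂ F θ hP g₀ os).vol ∧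
              (∀ (K : ℕ) (t : ℝ), |t| ≤ (crGap2₁₃VAx (fun _ => 0) ρ ρ' n₁ n₂ F θ hP g₀ os).l₀ →
                T4GenFunBounds.schemeZ ((datumOfRecord₁₃CoPHAx F 2 θ hP).scheme g₀) os ((crGap2₁₃VAx (fun _ => 0) ρ ρ' n₁ n₂ F θ hP g₀ os).K₀ + K) t =
                  ∑ τ ∈ (crGap2₁₃VAx (fun _ => 0) ρ ρ' n₁ n₂ F θ hP g₀ os).T K, (crGap2₁₃VAx (fun _ => 0) ρ ρ' n₁ n₂ F θ hP g₀ os).A K t τ) ∧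
              (∀ (K : ℕ) (t : ℝ), |t| ≤ (crGap2₁₃VAx (fun _ => 0) ρ ρ' n₁ n₂ F θ hP g₀ os).l₀ →
                T4GenFunBounds.schemeZ ((datumOfRecord₁₃CoPHAx F 2 θ hP).scheme g₀) os ((crGap2₁₃VAx (fun _ => 0) ρ ρ' n₁ n₂ F θ hP g₀ os).K₀ + K + 1) t =
                  ∑ τ ∈ (crGap2₁₃VAx (fun _ => 0) ρ ρ' n₁ n₂ F θ hP g₀ os).T K, (crGap2₁₃VAx (fun _ => 0) ρ ρ' n₁ n₂ F θ hP g₀ os).B K t τ)) ∧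
          (∀ (F : T4Family) (θ : Stage13HParams F 2) (h : θ.Provisos₁₃SepCoPHAx F 2) (v : Revision₁₃Ax F 2 θ h),
            ((θ.ZhUnity F 2 ∧ θ.SlotsNondegenerate₁₃Ax F 2) ∧ LiveSel F θ) → θ.Admissible F 2 →
            B16.EndStatementBPrinted (datumOfRecord₁₃SepCoPHVAx F 2 θ h v).C → DagBinding.EndpointExistence (datumOfRecord₁₃SepCoPHVAx F 2 θ h v).C.toB12 →
              ForSmallCouplings (datumOfRecord₁₃SepCoPHVAx F 2 θ h v) fun g₀ => ∀ os : List (ULoop F),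
                PHolderD4 β (datumOfRecord₁₃SepCoPHVAx F 2 θ h v) (rrOfRecord 𝔯 ksel F θ h.toCore g₀ os) →
                  letI := (crGap2₁₃VAx (fun _ => 0) ρ ρ' n₁ n₂ F θ h.toCore g₀ os).dec
                  ∃ δ : ℕ → ℝ, NE7.Core (crGap2₁₃VAx (fun _ => 0) ρ ρ' n₁ n₂ F θ h.toCore g₀ os).l₀ (crGap2₁₃VAx (fun _ => 0) ρ ρ' n₁ n₂ F θ h.toCore g₀ os).vol
                    (crGap2₁₃VAx (fun _ => 0) ρ ρ' n₁ n₂ F θ h.toCore g₀ os).T (crGap2₁₃VAx (fun _ => 0) ρ ρ' n₁ n₂ F θ h.toCore g₀ os).Bad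
                    (fun K t τ => (crGap2₁₃VAx (fun _ => 0) ρ ρ' n₁ n₂ F θ h.toCore g₀ os).A K t τ - (crGap2₁₃VAx (fun _ => 0) ρ ρ' n₁ n₂ F θ h.toCore g₀ os).shA K t τ)
                    (fun K t τ => (crGap2₁₃VAx (fun _ => 0) ρ ρ' n₁ n₂ F θ h.toCore g₀ os).B K t τ - (crGap2₁₃VAx (fun _ => 0) ρ ρ' n₁ n₂ F θ h.toCore g₀ os).shB K t τ) δ ∧
                    Summable δ) ∧
          (∀ (F : T4Family) (θ : Stage13HParams F 2) (hP : θ.Provisos₁₃CoPHAx F 2), ((θ.ZhUnity F 2 ∧ θ.SlotsNondegenerate₁₃Ax F 2) ∧ ¬ LiveSel F θ) →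
            θ.Admissible F 2 → ∀ (g₀ : ℕ → ℝ) (os : List (ULoop F)), PHolderD4 β (datumOfRecord₁₃CoPHAx F 2 θ hP) (rrOfRecord 𝔯 ksel F θ hP g₀ os) →
              ∃ δ : ℕ → ℝ, Target ((F.side : ℝ) ^ 4) 1 δ (fun K => T4GenFunBounds.schemeZ ((datumOfRecord₁₃CoPHAx F 2 θ hP).scheme g₀) os (0 + K)))) :
    ∀ β : ℝ, 2 / 3 < β → β < 1 →
      ∀ (𝔯 : RateReading13AxP) (ksel : RunSel) (ℓ : LetterReading) (ℓ₃ : T4Family → Node00.NE3Letters₁₁) (g B : T4Family → ℝ),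
        GuardedReadingN16 𝔯 ksel ℓ ℓ₃ g B → KeyedRatesHolderD4V β (rrOfRecord 𝔯 ksel) →
        ∃ (jc : CutReading) (ρ ρ' : WidthLetter₁₃CoPHAx 2) (n₁ n₂ : DepthLetter₁₃CoPHAx 2) (cr : SpineReading), PinnedAtLiveGap2 jc ρ ρ' n₁ n₂ cr ∧ DialRows ρ ρ' n₁ n₂ ∧
          KeyedRelWeight cr ∧ KeyedShellWeight cr ∧ KeyedExtractionV cr ∧ KeyedCoreEdgeHolderD4V β cr (rrOfRecord 𝔯 ksel) := by
  intro β hβ hβ' 𝔯 ksel ℓ ℓ₃ g B hg hr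
  obtain ⟨ρ, ρ', n₁, n₂, hd, h21, hx, h19, hoff19⟩ := h β hβ hβ' 𝔯 ksel ℓ ℓ₃ g B hg hr
  obtain ⟨cr, hon, hoff⟩ := exists_reading_livePin (crGap2₁₃VAx (fun _ => 0) ρ ρ' n₁ n₂)
  exact ⟨fun _ _ _ _ _ => fun _ => 0, ρ, ρ', n₁, n₂, cr, hon, hd, keyedRelWeight_of_liveGap2Pin_cutZero ρ ρ' n₁ n₂ hoff hon,
    keyedShellWeight_of_livePin hon hoff h21, keyedExtractionV_of_livePin hon hoff hx, keyedCoreEdgeHolderD4V_of_livePin hon hoff β (rrOfRecord 𝔯 ksel) h19 hoff19⟩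

end Summit.QuantumFields.YangMills.BalabanUVNodes.N20OffLiveOneTermReadingCmap

end
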